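import Summits.AtomisticToContinuum.Crystallization.Theses.ExcessDecayLiouville
import Summits.AtomisticToContinuum.Crystallization.Theses.HcpDefectCounting
import Literature.MathematicalPhysics.StatisticalMechanics.LennardJonesClusters
import Literature.MathematicalPhysics.StatisticalMechanics.BarlowStackingEnergy

/-!
# Sketch — crux `FineGrains` (stmt-AtomisticToContinuum-9330), round 1, ideator 3

First lemmas (as `Prop`s over existing declarations; nothing is proved here) of three lines:

* CARD `surface-order-squeeze` — energy form: `WindowCap`, `ReferenceFloor`, `ShiftCollar`,
  `WindowGrowth`, composed as `LineA`; force form (variant): `PatchSecantMonotone`,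
  `LevelOneFlatness`, composed as `LineC`.
* CARD `sibling-reduction-at-epsilon` — `IsoDictionaryAt` (the ε-dictionary), composed as `LineS`
  (the landed `CoarseGrains_of` re-run at tolerance ε).
* CARD `barlow-late-word-selection` — `FineBarlowGrains` (the transfer C⁺), `HaggDomination`,
  `GapConvexity`, composed as `LineB`.

Conventions are the crux's: `Λ = ℤu + ℤv + ℤ·2√(2/3)e₃` (`triangularVec₁/₂ 1`, `layerNormal`),
admissible cell `‖A − 0.97·O‖ ≤ 1/40`, `V = lennardJones = r⁻¹²/12 − r⁻⁶/6`.
-/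

noncomputable section

open Literature.MathematicalPhysics.StatisticalMechanics
open scoped BigOperators Classical

namespace Summit.AtomisticToContinuum.Crystallization.Cruxes.FineGrains.IdeatorThree

/-- `ℝ³`. -/
abbrev E3 := EuclideanSpace ℝ (Fin 3)

/-- The hexagonal period lattice `Λ` of the unit hcp stacking (the crux's `Λ`). -/
def Lam : Set E3 :=
  {z | ∃ i j k : ℤ, z = (i : ℝ) • triangularVec₁ 1 + (j : ℝ) • triangularVec₂ 1 +
    (k : ℝ) • layerNormal (2 * Real.sqrt (2 / 3))}

/-- Admissible cell (the crux's `Adm`). -/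
def Adm (A : E3 →L[ℝ] E3) : Prop :=
  ∃ R : E3 ≃ₗᵢ[ℝ] E3, ‖A - (97 / 100 : ℝ) • (R.toContinuousLinearEquiv : E3 →L[ℝ] E3)‖ ≤ 1 / 40

/-- Site set of the affine hcp two-lattice with sublattice translations `t` and cell `A`. -/
def Sites (t : Fin 2 → E3) (A : E3 →L[ℝ] E3) : Set E3 :=
  {p | ∃ m : Fin 2, ∃ z ∈ Lam, p = t m + A z}

/-- Two-way `ε`-matching of `X` with an arbitrary reference SET `S` on the closed ball `B_r(c)`
(the crux's `Near`, with the two-lattice replaced by a general reference set). -/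
def NearSet (X : Set E3) (c : E3) (r : ℝ) (S : Set E3) (ε : ℝ) : Prop :=
  (∀ p ∈ X, dist p c ≤ r → ∃ s ∈ S, dist p s ≤ ε) ∧
  (∀ s ∈ S, dist s c ≤ r → ∃ p ∈ X, dist p s ≤ ε)

/-- The Lennard-Jones pair force `∇V(e) = V′(|e|)·e/|e|` exerted along the bond vector `e`. -/
def pairForce (e : E3) : E3 := (deriv lennardJones ‖e‖ / ‖e‖) • e

/-- Force balance of a (possibly infinite) reference set at every one of its sites; for an affine
two-lattice `Sites t A` this says exactly that the inner displacement `t 1 − t 0` is RELAXED for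
the cell `A` (every Bravais sublattice is centrosymmetric, so only the optical force can fail). -/
def EquilSet (S : Set E3) : Prop :=
  ∀ p ∈ S, HasSum (fun q : {q : E3 // q ∈ S ∧ q ≠ p} => pairForce (p - q.1)) 0

/-- Self-energy `½ Σ_{p ≠ q ∈ P} V(|y p − y q|)` of the finite cluster obtained by placing the
labels `p ∈ P` at the positions `y p` (use `y = id` for the cluster `P` itself). -/
def selfEnergy (P : Finset E3) (y : E3 → E3) : ℝ :=
  (∑ p ∈ P, ∑ q ∈ P, if p ≠ q then lennardJones (dist (y p) (y q)) else 0) / 2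

/-- Nearest-neighbour Dirichlet form `Σ_{p,q ∈ P, |p−q| ≤ 11/10} |w p − w q|²` (ordered pairs; the
crux family's normalisation) of a displacement `w` on a finite patch `P` of reference labels. -/
def nnForm (P : Finset E3) (w : E3 → E3) : ℝ :=
  ∑ p ∈ P, ∑ q ∈ P, if dist p q ≤ 11 / 10 then ‖w p - w q‖ ^ 2 else 0

/-! ## CARD `surface-order-squeeze`, energy form (primary) -/

/-- A1 `WindowCap` (hereditary almost-minimality; provable now): every ball-window of every
Lennard-Jones ground state is within SURFACE order of the free ground-state energy of its own
particle number: `E_self(x ∩ B_R(c)) ≤ E(n) + C R²`.  Proof: `E(N) ≤ E(N − n) + E(n)`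
(juxtaposition far apart, `interactionEnergy_append`, `lennardJones_nonpos`), `E(N − n) ≤
E_self(rest)`, and the attractive cross terms between the window and the rest are `≤ C_δ R²` in
absolute value by the proved separation `LennardJonesMinimalDistance_holds` and the `r⁻⁶` tail. -/
def WindowCap : Prop :=
  ∃ C : ℝ, ∀ (N : ℕ) (x : Fin N → E3), IsGroundState lennardJones x →
    ∀ (c : E3) (R : ℝ), 1 ≤ R →
      ∀ P : Finset E3, (↑P = Set.range x ∩ Metric.closedBall c R) →
        selfEnergy P id ≤ groundStateEnergy lennardJones 3 P.card + C * R ^ 2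

/-- A2 `ReferenceFloor` (bookkeeping): a ball-patch of an admissible affine two-lattice has
self-energy `≥ n · e_per − C R²`, `e_per = ⨅_Q e(Q)`: its energy per particle `e(Sites t A)` is
`≥ e_per` BY DEFINITION of the infimum (`Sites t A` is a periodic configuration with lattice
`AΛ`, motif `{t 0, t 1}`; bounded below: `CrysPeriodicBddBelow`, proved), and truncation to the
ball only removes attractive pairs (`V ≤ 0` beyond `2^{-1/6} < 0.92 ≤` site spacing). -/
def ReferenceFloor : Prop :=
  ∃ C : ℝ, ∀ (t : Fin 2 → E3) (A : E3 →L[ℝ] E3), Adm A →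
    ∀ (c : E3) (R : ℝ), 1 ≤ R →
      ∀ P : Finset E3, (↑P = Sites t A ∩ Metric.closedBall c R) →
        (P.card : ℝ) * (⨅ Q : PeriodicConfiguration 3, Q.energyPerParticle lennardJones) - C * R ^ 2
          ≤ selfEnergy P id

/-- A3 `ShiftCollar` (finite-dimensional certified computation): for every admissible cell there
is a RELAXED inner displacement within `1/80` of the ideal one `A(w + √(2/3)e₃)` (floats:
`≤ 0.0104`, attained at the basal-shear corner; `0` for cells preserving the hexagonal symmetry). -/
def ShiftCollar : Prop :=
  ∀ A : E3 →L[ℝ] E3, Adm A → ∃ t : Fin 2 → E3, t 0 = 0 ∧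
    ‖t 1 - A (barlowOffset 1 + layerNormal (Real.sqrt (2 / 3)))‖ ≤ 1 / 80 ∧ EquilSet (Sites t A)

/-- A4 `WindowGrowth η κ` — THE BET of line A: quadratic ENERGY GROWTH (not convexity!) of the
Lennard-Jones patch energy away from every relaxed admissible two-lattice, uniformly on the
sup-tube of radius `η`, modulo a surface term:
`E_self(S + w) − E_self(S) ≥ κ · nnForm(w) − C R²` for all `|w| ≤ η` on `S ∩ B_R`.
Needed at `η = 1/16 ≥ 1/40 (matching) + 1/40 (Inner slack of CoarseGrains) + 1/80 (ShiftCollar)`.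
Floats (HcpLiouville crux, kit j008231, 7 window cells): best constant `R_en ≥ 0.22` at `η = 3/40`,
`≥ 0.30` at `1/20`, while tangent convexity dies at `η ≈ 0.036`. -/
def WindowGrowth (η κ : ℝ) : Prop :=
  ∃ C : ℝ, ∀ (t : Fin 2 → E3) (A : E3 →L[ℝ] E3), Adm A → EquilSet (Sites t A) →
    ∀ (c : E3) (R : ℝ), 1 ≤ R → ∀ w : E3 → E3, (∀ p, ‖w p‖ ≤ η) →
      ∀ P : Finset E3, (↑P = Sites t A ∩ Metric.closedBall c R) →
        κ * nnForm P w - C * R ^ 2 ≤ selfEnergy P (fun p => p + w p) - selfEnergy P id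

/-- LINE A composed (the skeleton a crux-plan seat would register; glue = OnePerSite bijection,
`E(n)/n → e_∞ ≤ e_per` (`BlancLewin2015_8_holds`, `crysEnergyUpper_proof`), the squeeze
`κ·nnForm ≤ 2CR² + n(E(n)/n − e_per)₊ = o(R³)`, pigeonhole over `(R/ρ)³` disjoint `ρ`-balls and a
path (Poincaré) bound on the connected hcp contact graph). -/
def LineA : Prop :=
  WindowCap → ReferenceFloor → ShiftCollar → (∃ κ : ℝ, 0 < κ ∧ WindowGrowth (1 / 16) κ) →
    _root_.Summit.AtomisticToContinuum.Crystallization.Theses.ExcessDecayLiouville.CoarseGrains →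
    _root_.Summit.AtomisticToContinuum.Crystallization.Theses.ExcessDecayLiouville.FineGrains

/-! ## CARD `surface-order-squeeze`, force form (variant) -/

/-- C1 `PatchSecantMonotone η κ` — the certificate of the FORCE form: secant self-monotonicity of
the Lennard-Jones force map on the sup-tube of radius `η` around every relaxed admissible
two-lattice, PATCH BY PATCH modulo a surface term:
`½ Σ_{p≠q ∈ P} ⟨∇V(e_pq + δw) − ∇V(e_pq), δw⟩ ≥ κ · nnForm_P(w) − C R²` for all `|w| ≤ η`
(each bond's secant depends only on its own `δw`: certification = one-dimensional integrals of
`V″, V′/r` along segments + a cellwise discrete Korn constant).  Floats (kit j008231, periodic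
fields): best constant `R_sec ≥ 0.21` at `η = 1/20`, `≥ 0.11` at `3/40` — alive at the needed `1/16`.
Integrating in the tube radius gives `WindowGrowth` (so this certificate is the STRONGER one). -/
def PatchSecantMonotone (η κ : ℝ) : Prop :=
  ∃ C : ℝ, ∀ (t : Fin 2 → E3) (A : E3 →L[ℝ] E3), Adm A → EquilSet (Sites t A) →
    ∀ (c : E3) (R : ℝ), 1 ≤ R → ∀ w : E3 → E3, (∀ p, ‖w p‖ ≤ η) →
      ∀ P : Finset E3, (↑P = Sites t A ∩ Metric.closedBall c R) →
        κ * nnForm P w - C * R ^ 2 ≤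
          (∑ p ∈ P, ∑ q ∈ P, if p ≠ q then
              inner ℝ (pairForce (p - q + (w p - w q)) - pairForce (p - q)) (w p - w q) else 0) / 2

/-- C2 `LevelOneFlatness η` — first lemma of the FORCE form (force balance tested ONCE, against the
displacement itself on a sharp ball): if a ground state is `η`-matched (bijectively, via `φ`) with
a relaxed admissible two-lattice on `B_{3R}(c)`, then the displacement `w = p − φ p` has
nearest-neighbour Dirichlet energy of SURFACE order `≤ C R²` on `B_R(c)` (against the trivial
`η² R³`).  Proof: `Σ_{p ∈ B_R} ⟨F_p(x) − F_p(S), w_p − c̄⟩ = 0 +` far field (`ForceBalance` 9335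
and `EquilSet`), antisymmetrisation turns the left side into the patch secant form minus the flux
through `∂B_R` (`≤ C R²`), and `PatchSecantMonotone` converts it into `κ · nnForm`.  (With a
CELLWISE certificate and a smooth cut-off the bound improves to `C η² R`, Caccioppoli proper.) -/
def LevelOneFlatness (η : ℝ) : Prop :=
  ∃ C R₀ : ℝ, ∀ (N : ℕ) (x : Fin N → E3), IsGroundState lennardJones x →
    ∀ (c : E3) (t : Fin 2 → E3) (A : E3 →L[ℝ] E3) (R : ℝ), Adm A → EquilSet (Sites t A) →
      R₀ ≤ R → ∀ φ : E3 → E3,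
        (∀ p ∈ Set.range x, dist p c ≤ 3 * R → φ p ∈ Sites t A ∧ dist p (φ p) ≤ η) →
        (∀ s ∈ Sites t A, dist s c ≤ 3 * R → ∃ p ∈ Set.range x, dist p c ≤ 3 * R + 1 ∧ φ p = s) →
        ∀ P : Finset E3, (↑P = Set.range x ∩ Metric.closedBall c R) →
          nnForm P (fun p => p - φ p) ≤ C * R ^ 2

/-- FORCE form composed (glue: OnePerSite bijection from two-way matching + separation,
`ShiftCollar` to pass from the CoarseGrains datum to the relaxed reference at tube radius `1/16`,
pigeonhole over `(R/ρ)³` disjoint `ρ`-balls — some ball has `nnForm ≤ C ρ³ / R` — and the path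
bound on the connected contact graph). -/
def LineC : Prop :=
  ShiftCollar → (∃ κ : ℝ, 0 < κ ∧ PatchSecantMonotone (1 / 16) κ) → LevelOneFlatness (1 / 16) →
    _root_.Summit.AtomisticToContinuum.Crystallization.Theses.ExcessDecayLiouville.ForceBalance →
    _root_.Summit.AtomisticToContinuum.Crystallization.Theses.ExcessDecayLiouville.CoarseGrains →
    _root_.Summit.AtomisticToContinuum.Crystallization.Theses.ExcessDecayLiouville.FineGrains

/-! ## CARD `sibling-reduction-at-epsilon` -/

/-- S1 `IsoDictionaryAt ε` — the isometric-chart dictionary of the landed CoarseGrains line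
(`stub_isoDictionary`, Theorems/ExcessDecayLiouvilleCoarseGrainsIsoDictionary.lean) with its
literal tolerance `1/40` replaced by a parameter `ε` (the landed proof is tolerance-agnostic: sites
of `x_i + A·hcp(a, c√(2/3))` ARE the sites `t_m + A'z` of an admissible two-lattice when
`|a − 0.97|, |c − 0.97| ≤ 1/40`, so matching distances pass through unchanged). -/
def IsoDictionaryAt (ε : ℝ) : Prop :=
  ∀ (a h : ℝ) (ha : a ≠ 0) (hh : h ≠ 0),
    |a - 97 / 100| ≤ 1 / 40 → |h / Real.sqrt (2 / 3) - 97 / 100| ≤ 1 / 40 →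
  ∀ (N : ℕ) (x : Fin N → E3) (i : Fin N) (R : ℝ),
    (∃ A : E3 →ₗᵢ[ℝ] E3,
      (∀ p ∈ (hcpPeriodicConfiguration ha hh).points, ‖p‖ ≤ R →
        ∃ j : Fin N, dist (x j) (x i + A p) ≤ ε) ∧
      (∀ j : Fin N, dist (x j) (x i) ≤ R →
        ∃ p ∈ (hcpPeriodicConfiguration ha hh).points, dist (x j) (x i + A p) ≤ ε)) →
    ∃ (c : E3) (t : Fin 2 → E3) (A' : E3 →L[ℝ] E3), Adm A' ∧
      (∀ p ∈ Set.range x, dist p c ≤ R → ∃ m : Fin 2, ∃ z ∈ Lam, dist p (t m + A' z) ≤ ε) ∧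
      (∀ m : Fin 2, ∀ z ∈ Lam, dist (t m + A' z) c ≤ R → ∃ p ∈ Set.range x, dist p (t m + A' z) ≤ ε)

/-- CARD `sibling-reduction-at-epsilon` composed: the landed `CoarseGrains_of` re-run with the
target tolerance `ε` in `trussPropagation` (landed, already `∀ ε`) and `IsoDictionaryAt ε` in place
of `stub_isoDictionary`; `HcpDefectCoercivity` is quantified over EVERY tolerance `θ`, so the
`θ(δ, ρ, ε)` of truss propagation is admissible and the clean-ball count is verbatim. -/
def LineS : Prop :=
  (∀ ε : ℝ, 0 < ε → ε ≤ 1 / 40 → IsoDictionaryAt ε) →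
    _root_.Summit.AtomisticToContinuum.Crystallization.Theses.HcpDefectCounting.HcpBulkFloor →
    _root_.Summit.AtomisticToContinuum.Crystallization.Theses.HcpDefectCounting.HcpDefectCoercivity →
    _root_.Summit.AtomisticToContinuum.Crystallization.Theses.ExcessDecayLiouville.FineGrains

/-! ## CARD `barlow-late-word-selection` (transfer C⁺ = `FineBarlowGrains`) -/

/-- The LAYERED close-packed reference coded by a Hägg word `s` and arbitrary layer heights `z`:
unit triangular layers, layer `k` laterally in letter position `haggLabel s k` (exact hole
registry), at height `z k` (gaps free).  `barlowStacking 1 h s` is the case `z k = k·h`;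
`hcpStacking`/`fccStacking` are the alternating/constant words. -/
def layeredSet (s : ℤ → ℤ) (z : ℤ → ℝ) : Set E3 :=
  {x | ∃ k i j : ℤ, x = (i : ℝ) • triangularVec₁ 1 + (j : ℝ) • triangularVec₂ 1 +
    (haggLabel s k : ℝ) • barlowOffset 1 + layerNormal (z k)}

/-- B1 `FineBarlowGrains` — the STACKING-BLIND, GAP-BLIND transfer `C⁺` of the crux: for all
`ρ, ε`, every large ground state contains a ball two-way `ε`-matched with an admissible affine
image of SOME layered close-packed configuration (any Hägg word, any gaps) — nothing about hcp,
nothing about the `7·10⁻⁵` stacking energetics, nothing about the optical/gap rigidity.  Line B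
supplies `FineBarlowGrains → FineGrains` from the two-sided window budget, certified Hägg
domination (`HaggDomination`) and gap convexity (`GapConvexity`). -/
def FineBarlowGrains : Prop :=
  ∀ ρ ε : ℝ, 0 < ρ → 0 < ε → ∃ N₀ : ℕ, ∀ N : ℕ, N₀ ≤ N → ∀ x : Fin N → E3,
    IsGroundState lennardJones x →
      ∃ (c τ : E3) (s : ℤ → ℤ) (z : ℤ → ℝ) (A : E3 →L[ℝ] E3), IsHaggSeq s ∧ Adm A ∧
        NearSet (Set.range x) c ρ ((fun y => τ + A y) '' layeredSet s z) ε

/-- B2 `HaggDomination` — certified interval lattice sums (computation): on a box around the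
relaxed hcp cell the second-layer coupling `J₂ = Φ_A(2) − Φ_N(2)` (`barlowCoupling`) is negative
and dominates all farther couplings, `J₂ < 0` and `Σ_{k≥3} k·|J_k| ≤ |J₂|/4` (floats:
`J₂ = −7.26·10⁻⁵`, `|J₃| ≈ 4·10⁻⁸` at `(a, h) = (0.9713, 0.7929)`; refuter scan: all 61 Barlow words
of period `≤ 8` with a `c`-letter lie `7.20–7.25·10⁻⁵` per `c`-layer atom above hcp, re-relaxed),
so in every exact layered configuration of the box each `c`-letter costs `≥ |J₂|/2` per atom. -/
def HaggDomination : Prop :=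
  ∀ a h : ℝ, 24 / 25 ≤ a → a ≤ 49 / 50 → 157 / 200 ≤ h → h ≤ 4 / 5 →
    barlowCoupling lennardJones a h 2 < 0 ∧
    (∑' k : ℕ, ((k : ℝ) + 3) * |barlowCoupling lennardJones a h (k + 3)|)
      ≤ -(barlowCoupling lennardJones a h 2) / 4

/-- B3 `GapConvexity` — certified (computation): the nearest-layer interaction `Φ_N(1)(a, ·)` is
uniformly convex in the gap on the box and dominates the farther layers
(floats, kit j008962 of crux 13603: `φ₁″ ≥ 3.10`, `Σ_{k≥2} k|φ_k″| ≤ 0.142 φ₁″`), so in an all-`h`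
fine window the budget forces near-constant gaps on a sub-window (pigeonhole in one dimension). -/
def GapConvexity : Prop :=
  ∃ m : ℝ, 0 < m ∧ ∀ a : ℝ, 24 / 25 ≤ a → a ≤ 49 / 50 → ∀ g₁ g₂ : ℝ,
    157 / 200 ≤ g₁ → g₁ ≤ 4 / 5 → 157 / 200 ≤ g₂ → g₂ ≤ 4 / 5 →
      m * (g₁ - g₂) ^ 2 ≤ layerInteraction lennardJones a g₁ 1 1 + layerInteraction lennardJones a g₂ 1 1
        - 2 * layerInteraction lennardJones a ((g₁ + g₂) / 2) 1 1

/-- LINE B composed (glue: exact layer decomposition of the energy of an affine layered patch,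
`barlowSiteEnergy_eq`; Lipschitz continuity of `selfEnergy` under `ε`-matchings of separated
sets; the two-sided budget `WindowCap` + periodisation floor; the word lemma "c-letter density
`< 1/(2ℓ)` among `L` consecutive letters ⇒ some `ℓ` consecutive letters are all `h`"; gap
pigeonhole; an all-`h`, constant-gap fine layered ball is an affine hcp two-lattice ball,
`hcp_layer_add_two`). -/
def LineB : Prop :=
  FineBarlowGrains → HaggDomination → GapConvexity → WindowCap →
    _root_.Summit.AtomisticToContinuum.Crystallization.Theses.ExcessDecayLiouville.FineGrains

end Summit.AtomisticToContinuum.Crystallization.Cruxes.FineGrains.IdeatorThree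

end
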